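import Literature.AnabelianGeometry.AbsoluteAnabelian.AbsTopIThm26iProofs
import Literature.AnabelianGeometry.AbsoluteAnabelian.InvariantCharacterTransferProofs
import Literature.AnabelianGeometry.AbsoluteAnabelian.FreeProlRankLinearProofs
import Literature.AnabelianGeometry.AbsoluteAnabelian.FreeProcyclicStructure
import HarnessLib

/-!
# [AbsTopI] Thm 2.6 (i): the Weil input is EXACTLY the residual — tightness of `thm26i_of_isFreeProcyclic`

S. Mochizuki, *Topics in Absolute Anabelian Geometry I: Generalities* (2012) [AbsTopI], Thm 2.6 (i),
manuscript p. 21 (lit key `paper:url-11ac98ba15fc`), proof p. 23 ll. 3–7: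

  "The remainder of assertion (i) follows immediately from the fact that `T_l(A)/G = 0` [a
   consequence of the "Riemann hypothesis for abelian varieties over finite fields" — cf., e.g.,
   [Mumf], p. 206]."

Proof-only companion (no definitions, no named facts) of abc-iut-L4-t4's statement file
`AbsTopISemiAbsolute.lean` (`FundamentalExtension.Thm26i`) and of `AbsTopIThm26iProofs.lean`, where
the typed Thm 2.6 (i) is PROVED for every abstract extension `1 → Δ → Π → G → 1` from "`G ≅ Ẑ`"
(`IsFreeProcyclic E.gal`), Prop 2.2 (`E.GeomTFG`) and the hypothesis `hT` = the group-theoretic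
content of "`T_l(A_H)/G_H = 0`": every `H`-invariant continuous character `Δ ∩ H → ℤ_l` is trivial,
for every open `H ⊆ Π` and every prime `l` (GAP-LEDGER row G-L4t4-1 of cell abc-iut: Weil's theorem is
outside the tree's interface — no Tate modules, no étale `π₁`).

HERE the CONVERSE is kernel-checked: for every extension with `G ≅ Ẑ`, the typed conclusion
`E.Thm26i` — indeed its rank clause "`δ¹_l(H) = 1` for every open `H` and every `l`" alone — IMPLIES
`hT`.  Hence, given `G ≅ Ẑ` and Prop 2.2,

  `E.Thm26i ↔ hT ↔ (∀ open H, ∀ l, δ¹_l(H) = 1)`  (`thm26i_iff_of_isFreeProcyclic`,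
  `thm26i_iff_rank_of_isFreeProcyclic`),

so the hypothesis `hT` of `thm26i_of_isFreeProcyclic` is not merely sufficient but NECESSARY: no
weaker input can discharge the node, and no named fact short of one implying the rank clause itself
can replace it (the cell's census question "is G-L4t4-1 reducible to frozen FACT rows by name?" —
answer: only to rows that imply Thm 2.6 (i)'s own rank clause at the given data).

The mechanism ("`Ẑ` is projective", classical):
* `exists_continuousSection_of_isFreeProcyclic` — a continuous surjection `π : P ↠ Z` from a
  profinite group onto a free procyclic group has a continuous homomorphic SECTION: for a lift
  `h₀` of a topological generator `γ` of `Z`, the procyclic closed subgroup `C = closure ⟨h₀⟩` maps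
  onto `Z` (compact image containing the dense `⟨γ⟩`) and injectively (an element of the kernel
  lies in every open subgroup of `C`, because the open subgroup of index `n` of a group with a dense
  cyclic subgroup is unique — `eq_closureZpowersPow_of_isOpen_of_index` — and is therefore the
  preimage of the index-`n` open subgroup of `Z`); a continuous bijection of a compact group onto a
  Hausdorff group is a homeomorphism;
* hence `E.SplitsOverOpenSubgroup` (the standing hypothesis of [AbsAnab] §1.1) for every extension
  with `G ≅ Ẑ` (`splitsOverOpenSubgroup_of_isFreeProcyclic`), and every `H`-invariant continuous
  character of `Δ ∩ H` EXTENDS to `H` (abc-iut-L4-d3's transfer lemma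
  `exists_extension_pow_index` at index `1`);
* an extension `Φ` of a nontrivial invariant character and the pull-back `χ` of a surjective
  character `G_H ↠ ℤ_l` (`G_H ≅ Ẑ`, `δ¹_l(G_H) = 1`) are `ℚ_l`-linearly independent, so
  `δ¹_l(H) ≥ 2` (`le_freeProlRank_of_linearIndependent`) — contradicting `δ¹_l(H) = 1`.

HONEST FRAMING: [AbsTopI] is a refereed, undisputed paper; nothing here bears on [IUTchIII]
Cor. 3.12; typed ≠ proved elsewhere; the Weil input `hT` stays an explicit hypothesis of the
forward direction — this file shows it cannot be weakened, it does not supply it.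
-/

noncomputable section

open Topology

namespace Literature.AnabelianGeometry.AbsoluteAnabelian

universe u v

/-! ### Sections over free procyclic quotients ("`Ẑ` is projective") -/

section Section

variable {P : Type u} [Group P] [TopologicalSpace P] [IsTopologicalGroup P] [CompactSpace P]
  [T2Space P] [TotallyDisconnectedSpace P]
variable {Z : Type v} [Group Z] [TopologicalSpace Z] [T2Space Z]

/-- **A continuous surjection of a profinite group onto a free procyclic group has a continuous
section.**  If `π : P ↠ Z` is a continuous surjective homomorphism, `P` profinite and `Z ≅ Ẑ` (dense
cyclic subgroup `⟨γ⟩`, an open subgroup of every positive index), then for any lift `h₀` of `γ` the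
closed procyclic subgroup `C = closure ⟨h₀⟩ ⊆ P` maps homeomorphically and isomorphically onto `Z`,
so `π` admits a continuous homomorphic section `s : Z → P` (with image `C`).  This is the
projectivity of `Ẑ` ("`G ≅ Ẑ`", [AbsTopI] Thm 2.6 (i) p. 21, is what makes the extension
`1 → Δ → Π → G → 1` split). [cite: RibesZalesskii2010, Thm 2.7.1] -/
theorem exists_continuousSection_of_isFreeProcyclic
    (hZ : FundamentalExtension.IsFreeProcyclic Z) (π : P →ₜ* Z) (hπ : Function.Surjective π) :
    ∃ s : Z →ₜ* P, ∀ z, π (s z) = z := by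
  classical
  obtain ⟨γ, hγ⟩ := hZ.exists_dense_zpowers
  obtain ⟨h₀, hh₀⟩ := hπ γ
  -- the procyclic closed subgroup `C = closure ⟨h₀⟩`
  set C : Subgroup P := (Subgroup.zpowers h₀).topologicalClosure with hC
  have hCc : IsClosed (C : Set P) := Subgroup.isClosed_topologicalClosure _
  haveI : CompactSpace C := isCompact_iff_compactSpace.mp hCc.isCompact
  have hh₀C : h₀ ∈ C := Subgroup.le_topologicalClosure _ (Subgroup.mem_zpowers h₀)
  -- its topological generator
  have hc₀ : Dense ((Subgroup.zpowers (⟨h₀, hh₀C⟩ : C) : Subgroup C) : Set C) := by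
    have himg : Subtype.val '' ((Subgroup.zpowers (⟨h₀, hh₀C⟩ : C) : Subgroup C) : Set C) =
        ((Subgroup.zpowers h₀ : Subgroup P) : Set P) := by
      rw [← Subgroup.coe_subtype, ← Subgroup.coe_map, MonoidHom.map_zpowers]
      rfl
    rw [dense_iff_closure_eq, Set.eq_univ_iff_forall]
    intro x
    rw [closure_subtype, himg, ← Subgroup.topologicalClosure_coe]
    exact x.2
  -- the restriction of `π` to `C`
  let πC : C →* Z := π.toMonoidHom.comp C.subtype
  have hπCc : Continuous πC := π.continuous.comp continuous_subtype_val
  have hπC₀ : πC ⟨h₀, hh₀C⟩ = γ := hh₀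
  -- `π(C) = Z`: compact image containing the dense `⟨γ⟩`
  have hsurj : Function.Surjective πC := by
    intro z
    have hcl : IsClosed (Set.range πC) := (isCompact_range hπCc).isClosed
    have hsub : ((Subgroup.zpowers γ : Subgroup Z) : Set Z) ⊆ Set.range πC := by
      intro y hy
      obtain ⟨k, rfl⟩ := Subgroup.mem_zpowers_iff.mp hy
      exact ⟨⟨h₀, hh₀C⟩ ^ k, by rw [map_zpow, hπC₀]⟩
    have huniv : Set.range πC = Set.univ := by
      apply Set.eq_univ_of_univ_subset
      rw [← hγ.closure_eq]
      exact closure_minimal hsub hcl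
    have hz : z ∈ Set.range πC := by rw [huniv]; trivial
    exact hz
  -- `π|_C` is injective: a kernel element lies in every open subgroup of `C`
  have hinj : Function.Injective πC := by
    rw [← MonoidHom.ker_eq_bot_iff, eq_bot_iff]
    intro c hc
    rw [MonoidHom.mem_ker] at hc
    rw [Subgroup.mem_bot]
    apply eq_one_of_forall_isOpen_mem
    intro V hV
    haveI : Finite (C ⧸ V) := Subgroup.quotient_finite_of_isOpen V hV
    haveI : V.FiniteIndex := Subgroup.finiteIndex_of_finite_quotient
    have hn0 : 0 < V.index := Nat.pos_of_ne_zero Subgroup.FiniteIndex.index_ne_zero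
    -- the open subgroup of `Z` of the same index, pulled back to `C`
    obtain ⟨W, hWo, hWi⟩ := hZ.exists_isOpen_index V.index hn0
    have hV'o : IsOpen ((W.comap πC : Subgroup C) : Set C) := hWo.preimage hπCc
    have hV'i : (W.comap πC).index = V.index := by
      rw [Subgroup.index_comap_of_surjective W hsurj, hWi]
    have h1 := eq_closureZpowersPow_of_isOpen_of_index hc₀ hV hn0 rfl
    have h2 := eq_closureZpowersPow_of_isOpen_of_index hc₀ hV'o hn0 hV'i
    rw [h1, ← h2, Subgroup.mem_comap, hc]
    exact W.one_mem
  -- the continuous inverse `Z ≅ C ⊆ P`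
  let e : C ≃* Z := MulEquiv.ofBijective πC ⟨hinj, hsurj⟩
  have he : Continuous e.symm :=
    Continuous.continuous_symm_of_equiv_compact_to_t2 (f := e.toEquiv) hπCc
  refine ⟨⟨C.subtype.comp e.symm.toMonoidHom, continuous_subtype_val.comp he⟩, fun z => ?_⟩
  change πC (e.symm z) = z
  exact MulEquiv.ofBijective_apply_symm_apply πC ⟨hinj, hsurj⟩

end Section

namespace FundamentalExtension

variable (E : FundamentalExtension.{u})

/-! ### Consequences for an extension `1 → Δ → Π → G → 1` with `G ≅ Ẑ` -/

/-- **For `G ≅ Ẑ` the augmentation `Π ↠ G` has a continuous homomorphic section** (`Ẑ` is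
projective; [AbsTopI] Thm 2.6 (i), `k` an FF, where `G = G_k ≅ Ẑ`).
[cite: MochizukiAbsTopI2012, Thm 2.6 (i) p.21] -/
theorem exists_section_of_isFreeProcyclic (hG : IsFreeProcyclic E.gal) :
    ∃ s : E.gal →ₜ* E.arith, ∀ g, E.aug (s g) = g :=
  exists_continuousSection_of_isFreeProcyclic hG E.aug E.aug_surjective

/-- **For `G ≅ Ẑ` the extension splits over an open subgroup of `G`** — indeed over `G` itself —,
i.e. the standing hypothesis `SplitsOverOpenSubgroup` of [AbsAnab] §1.1 (p. 7) holds for every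
extension whose quotient is free procyclic (e.g. base field an FF, [AbsTopI] Thm 2.6 (i)).
[cite: MochizukiAbsTopI2012, Thm 2.6 (i) p.21] -/
theorem splitsOverOpenSubgroup_of_isFreeProcyclic (hG : IsFreeProcyclic E.gal) :
    E.SplitsOverOpenSubgroup := by
  obtain ⟨s, hs⟩ := E.exists_section_of_isFreeProcyclic hG
  refine ⟨⊤, ⟨s.toMonoidHom.comp (⊤ : Subgroup E.gal).subtype,
    s.continuous.comp continuous_subtype_val⟩, ?_, fun u => hs u⟩
  rw [Subgroup.coe_top]
  exact isOpen_univ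

/-- **Invariant characters of `Δ ∩ H` extend to `H` when `G ≅ Ẑ`.**  For an open subgroup `H ⊆ Π`,
its image `G_H ⊆ G ≅ Ẑ` is open, hence free procyclic, so `H ↠ G_H` has a continuous section and
abc-iut-L4-d3's transfer lemma (`exists_extension_pow_index`, here at index `1`) extends every
`H`-invariant continuous homomorphism `ψ : Δ ∩ H → A` into a commutative topological group to a
continuous homomorphism `Φ : H → A`.  (This is the vanishing of the transgression obstruction
`H²(G_H, A) = 0` behind "`Π^{ab-t} ↠ G^{ab-t}` [...] `T_l(A)/G`" in the proof of Thm 2.6 (i), p. 23.)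
[cite: MochizukiAbsTopI2012, Thm 2.6 (i) p.21] -/
theorem exists_extension_of_isFreeProcyclic (hG : IsFreeProcyclic E.gal)
    (H : Subgroup E.arith) (hH : IsOpen (H : Set E.arith))
    {A : Type v} [CommGroup A] [TopologicalSpace A] [IsTopologicalGroup A]
    (ψ : ↥(E.geom ⊓ H) →ₜ* A)
    (hψ : ∀ g ∈ H, ∀ (d d' : ↥(E.geom ⊓ H)), (d' : E.arith) = g * d * g⁻¹ → ψ d' = ψ d) :
    ∃ Φ : H →ₜ* A, ∀ d : ↥(E.geom ⊓ H),
      Φ ⟨(d : E.arith), (Subgroup.mem_inf.mp d.2).2⟩ = ψ d := by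
  classical
  set G' : Subgroup E.gal := H.map E.aug.toMonoidHom with hG'
  haveI : CompactSpace H := isCompact_iff_compactSpace.mp (H.isClosed_of_isOpen hH).isCompact
  have hG'o : IsOpen (G' : Set E.gal) := E.isOpen_aug_map_of_isOpen H hH
  let π : H →ₜ* G' :=
    ⟨E.aug.toMonoidHom.subgroupMap H,
      continuous_induced_rng.2 ((map_continuous E.aug).comp continuous_subtype_val)⟩
  have hπ : Function.Surjective π := E.aug.toMonoidHom.subgroupMap_surjective H
  have hπval : ∀ x : H, ((π x : G') : E.gal) = E.aug x := fun x => rfl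
  -- `G_H` is free procyclic: a continuous section of `H ↠ G_H`
  obtain ⟨s, hs⟩ := exists_continuousSection_of_isFreeProcyclic (hG.subgroup_of_isOpen G' hG'o) π hπ
  -- `D = Δ ∩ H` inside `H`
  let D : Subgroup H := E.geom.subgroupOf H
  haveI hDn : D.Normal := E.normal_geom.subgroupOf H
  have hD : ∀ x : H, x ∈ D ↔ π x = 1 := by
    intro x
    rw [Subgroup.mem_subgroupOf, mem_geom]
    constructor
    · intro h; apply Subtype.ext; rw [hπval]; simpa using h
    · intro h
      have := congrArg (fun y : G' => (y : E.gal)) h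
      simpa [hπval] using this
  -- the splitting `r = s ∘ π` over `P₁ = H` itself
  let r : (⊤ : Subgroup H) →ₜ* H :=
    ⟨(s.toMonoidHom.comp π.toMonoidHom).comp (⊤ : Subgroup H).subtype,
      (s.continuous.comp π.continuous).comp continuous_subtype_val⟩
  have hrval : ∀ p : (⊤ : Subgroup H), r p = s (π (p : H)) := fun p => rfl
  have hr : ∀ p : (⊤ : Subgroup H), (p : H) * (r p)⁻¹ ∈ D := by
    intro p
    rw [hD, map_mul, map_inv, hrval, hs, mul_inv_cancel]
  have hrD : ∀ p : (⊤ : Subgroup H), (p : H) ∈ D → r p = 1 := by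
    intro p hp
    rw [hD] at hp
    rw [hrval, hp, map_one]
  -- transport `ψ` to `D`
  let ι : D →* ↥(E.geom ⊓ H) :=
    { toFun := fun d => ⟨((d : H) : E.arith),
        Subgroup.mem_inf.mpr ⟨Subgroup.mem_subgroupOf.mp d.2, (d : H).2⟩⟩
      map_one' := rfl
      map_mul' := fun _ _ => rfl }
  have hι : Continuous ι := (continuous_subtype_val.comp continuous_subtype_val).subtype_mk _
  let φ : D →ₜ* A := ⟨ψ.toMonoidHom.comp ι, ψ.continuous.comp hι⟩
  have hφ : ∀ (g : H) (d : D), φ ⟨g * d * g⁻¹, hDn.conj_mem _ d.2 g⟩ = φ d := by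
    intro g d
    change ψ (ι ⟨g * d * g⁻¹, hDn.conj_mem _ d.2 g⟩) = ψ (ι d)
    exact hψ (g : E.arith) g.2 (ι d) (ι ⟨g * d * g⁻¹, hDn.conj_mem _ d.2 g⟩) rfl
  have htop : IsOpen (((⊤ : Subgroup H) : Subgroup H) : Set H) := by
    rw [Subgroup.coe_top]
    exact isOpen_univ
  obtain ⟨Φ, hΦ⟩ := exists_extension_pow_index D ⊤ htop le_top r hr hrD φ hφ
  refine ⟨Φ, fun d => ?_⟩
  have hdD : (⟨(d : E.arith), (Subgroup.mem_inf.mp d.2).2⟩ : H) ∈ D :=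
    Subgroup.mem_subgroupOf.mpr (Subgroup.mem_inf.mp d.2).1
  have h1 := hΦ ⟨⟨(d : E.arith), (Subgroup.mem_inf.mp d.2).2⟩, hdD⟩
  rw [Subgroup.index_top, pow_one] at h1
  rw [h1]
  rfl

/-- For an open `H ⊆ Π` with `G ≅ Ẑ` there is a SURJECTIVE continuous character `H ↠ ℤ_l` killing
`Δ ∩ H`: the pull-back of a coordinate of `G_H ≅ Ẑ ↠ ℤ_l` (`δ¹_l(G_H) = 1`, `G_H ⊆ G` open hence
free procyclic). [cite: MochizukiAbsTopI2012, Thm 2.6 (i) p.21] -/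
theorem exists_character_surjective_of_isFreeProcyclic (hG : IsFreeProcyclic E.gal)
    (H : Subgroup E.arith) (hH : IsOpen (H : Set E.arith)) (l : ℕ) [Fact l.Prime] :
    ∃ χ : H →ₜ* Multiplicative ℤ_[l], Function.Surjective χ ∧
      ∀ x : H, (x : E.arith) ∈ E.geom → χ x = 1 := by
  classical
  set G' : Subgroup E.gal := H.map E.aug.toMonoidHom with hG'
  have hG'o : IsOpen (G' : Set E.gal) := E.isOpen_aug_map_of_isOpen H hH
  haveI : CompactSpace G' :=
    isCompact_iff_compactSpace.mp (G'.isClosed_of_isOpen hG'o).isCompact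
  let π : H →ₜ* G' :=
    ⟨E.aug.toMonoidHom.subgroupMap H,
      continuous_induced_rng.2 ((map_continuous E.aug).comp continuous_subtype_val)⟩
  have hπ : Function.Surjective π := E.aug.toMonoidHom.subgroupMap_surjective H
  have hπval : ∀ x : H, ((π x : G') : E.gal) = E.aug x := fun x => rfl
  -- `δ¹_l(G_H) = 1`: a continuous surjection `G_H ↠ ℤ_l^N`, `N ≥ 1`
  have hrk : freeProlRank G' l = 1 := (hG.subgroup_of_isOpen G' hG'o).freeProlRank_eq_one l
  obtain ⟨N, F, hN, hF⟩ :=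
    exists_surjective_of_le_freeProlRank (H := G') l (n := 1) one_pos (le_of_eq hrk.symm)
  let i₀ : Fin N := ⟨0, hN⟩
  -- the `i₀`-th coordinate
  let pr : Multiplicative (Fin N → ℤ_[l]) →* Multiplicative ℤ_[l] :=
    AddMonoidHom.toMultiplicative (Pi.evalAddMonoidHom (fun _ : Fin N => ℤ_[l]) i₀)
  have hpr : Continuous pr :=
    continuous_ofAdd.comp ((continuous_apply i₀).comp continuous_toAdd)
  refine ⟨⟨pr.comp (F.toMonoidHom.comp π.toMonoidHom), hpr.comp (F.continuous.comp π.continuous)⟩,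
    ?_, ?_⟩
  · intro a
    obtain ⟨g, hg⟩ := hF (Multiplicative.ofAdd fun _ => Multiplicative.toAdd a)
    obtain ⟨x, rfl⟩ := hπ g
    refine ⟨x, ?_⟩
    change pr (F (π x)) = a
    rw [hg]
    rfl
  · intro x hx
    have hπx : π x = 1 := by
      apply Subtype.ext
      rw [hπval]
      simpa using (mem_geom (E := E)).mp hx
    change pr (F (π x)) = 1
    rw [hπx, map_one, map_one]

/-! ### Tightness: the rank clause of Thm 2.6 (i) forces the Weil input -/

/-- **`δ¹_l(H) ≤ 1` forces the `H`-invariant characters of `Δ ∩ H` to vanish (for `G ≅ Ẑ`).**  If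
`ψ : Δ ∩ H → ℤ_l` were a nontrivial `H`-invariant continuous character, its extension `Φ : H → ℤ_l`
(`exists_extension_of_isFreeProcyclic`) and the pull-back `χ` of a surjective character `G_H ↠ ℤ_l`
would be `ℚ_l`-linearly independent (evaluate at a point of `Δ ∩ H` where `ψ ≠ 1`, then at a point
where `χ` takes the value `1 ∈ ℤ_l`), whence `δ¹_l(H) ≥ 2`.  So the Weil input "`T_l(A_H)/G_H = 0`"
of [AbsTopI] Thm 2.6 (i) (proof p. 23) is implied by the conclusion "`δ¹_l(H) = 1`".
[cite: MochizukiAbsTopI2012, Thm 2.6 (i) p.21] -/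
theorem invariantCharacters_trivial_of_freeProlRank_le_one (hG : IsFreeProcyclic E.gal)
    (H : Subgroup E.arith) (hH : IsOpen (H : Set E.arith)) (l : ℕ) [Fact l.Prime]
    (hrk : freeProlRank H l ≤ 1)
    (ψ : ↥(E.geom ⊓ H) →ₜ* Multiplicative ℤ_[l])
    (hψ : ∀ g ∈ H, ∀ (d d' : ↥(E.geom ⊓ H)), (d' : E.arith) = g * d * g⁻¹ → ψ d' = ψ d) :
    ∀ d, ψ d = 1 := by
  classical
  haveI : CompactSpace H := isCompact_iff_compactSpace.mp (H.isClosed_of_isOpen hH).isCompact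
  by_contra hne
  push Not at hne
  obtain ⟨d₀, hd₀⟩ := hne
  obtain ⟨Φ, hΦ⟩ := E.exists_extension_of_isFreeProcyclic hG H hH ψ hψ
  obtain ⟨χ, hχs, hχD⟩ := E.exists_character_surjective_of_isFreeProcyclic hG H hH l
  -- the two characters as `ℚ_l`-valued functions on `H`
  let u : Fin 2 → (H →ₜ* Multiplicative ℤ_[l]) := ![Φ, χ]
  have hli : LinearIndependent ℚ_[l]
      (fun (i : Fin 2) (h : H) => ((Multiplicative.toAdd (u i h) : ℤ_[l]) : ℚ_[l])) := by
    have hfun : (fun (i : Fin 2) (h : H) => ((Multiplicative.toAdd (u i h) : ℤ_[l]) : ℚ_[l])) =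
        ![fun h : H => ((Multiplicative.toAdd (Φ h) : ℤ_[l]) : ℚ_[l]),
          fun h : H => ((Multiplicative.toAdd (χ h) : ℤ_[l]) : ℚ_[l])] := by
      funext i
      fin_cases i <;> rfl
    rw [hfun, LinearIndependent.pair_iff]
    intro a b hab
    -- evaluate at `d₀ ∈ Δ ∩ H`: `χ` vanishes there and `ψ d₀ ≠ 1`
    let x₀ : H := ⟨(d₀ : E.arith), (Subgroup.mem_inf.mp d₀.2).2⟩
    have hχ₀ : χ x₀ = 1 := hχD x₀ (Subgroup.mem_inf.mp d₀.2).1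
    have hΦ₀ : Φ x₀ = ψ d₀ := hΦ d₀
    have h0 := congrFun hab x₀
    simp only [Pi.add_apply, Pi.smul_apply, smul_eq_mul, Pi.zero_apply, hχ₀, hΦ₀, toAdd_one,
      PadicInt.coe_zero, mul_zero, add_zero] at h0
    have hψ₀ : ((Multiplicative.toAdd (ψ d₀) : ℤ_[l]) : ℚ_[l]) ≠ 0 := by
      intro h
      apply hd₀
      have h' : (Multiplicative.toAdd (ψ d₀) : ℤ_[l]) = 0 := PadicInt.coe_eq_zero.mp h
      rw [← ofAdd_toAdd (ψ d₀), h']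
      rfl
    have ha : a = 0 := (mul_eq_zero.mp h0).resolve_right hψ₀
    -- evaluate at a point where `χ = ofAdd 1`
    obtain ⟨x₁, hx₁⟩ := hχs (Multiplicative.ofAdd 1)
    have h1 := congrFun hab x₁
    simp only [Pi.add_apply, Pi.smul_apply, smul_eq_mul, Pi.zero_apply, ha, zero_mul, zero_add,
      hx₁, toAdd_ofAdd, PadicInt.coe_one, mul_one] at h1
    exact ⟨ha, h1⟩
  have h2 := le_freeProlRank_of_linearIndependent l u hli
  have h21 : ((2 : ℕ) : ℕ∞) ≤ 1 := h2.trans hrk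
  have : (2 : ℕ) ≤ 1 := by exact_mod_cast h21
  omega

/-- **Thm 2.6 (i) AS TYPED implies the Weil input**: for every extension with `G ≅ Ẑ` satisfying
`E.Thm26i`, every `H`-invariant continuous character `Δ ∩ H → ℤ_l` is trivial, for every open
`H ⊆ Π` and every prime `l` (the rank clause "`δ¹_l(H) = 1`" suffices).  Converse of
`thm26i_of_isFreeProcyclic`'s use of `hT`. [cite: MochizukiAbsTopI2012, Thm 2.6 (i) p.21] -/
theorem invariantCharacters_trivial_of_thm26i (hG : IsFreeProcyclic E.gal) (h : E.Thm26i) :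
    ∀ (H : Subgroup E.arith), IsOpen (H : Set E.arith) → ∀ (l : ℕ) [Fact l.Prime]
      (ψ : ↥(E.geom ⊓ H) →ₜ* Multiplicative ℤ_[l]),
      (∀ g ∈ H, ∀ (d d' : ↥(E.geom ⊓ H)), (d' : E.arith) = g * d * g⁻¹ → ψ d' = ψ d) →
        ∀ d, ψ d = 1 :=
  fun H hH l _ ψ hψ =>
    E.invariantCharacters_trivial_of_freeProlRank_le_one hG H hH l (le_of_eq (h.2.2 H hH l)) ψ hψ

/-- **TIGHTNESS of the discharge of [AbsTopI] Thm 2.6 (i).**  For every extension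
`1 → Δ → Π → G → 1` with `G ≅ Ẑ` (`k` an FF) and `Δ` topologically finitely generated (Prop 2.2),
the typed Thm 2.6 (i) is EQUIVALENT to the Weil input `hT` ("`T_l(A_H)/G_H = 0`": the `H`-invariant
continuous characters `Δ ∩ H → ℤ_l` vanish for every open `H` and every `l`) — `→` by
`invariantCharacters_trivial_of_thm26i`, `←` by `thm26i_of_isFreeProcyclic`.  The hypothesis `hT`
(GAP-LEDGER G-L4t4-1) is thus the exact residual content of the node: necessary and sufficient.
[cite: MochizukiAbsTopI2012, Thm 2.6 (i) p.21] -/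
theorem thm26i_iff_of_isFreeProcyclic (hG : IsFreeProcyclic E.gal) (hΔ : E.GeomTFG) :
    E.Thm26i ↔
      ∀ (H : Subgroup E.arith), IsOpen (H : Set E.arith) → ∀ (l : ℕ) [Fact l.Prime]
        (ψ : ↥(E.geom ⊓ H) →ₜ* Multiplicative ℤ_[l]),
        (∀ g ∈ H, ∀ (d d' : ↥(E.geom ⊓ H)), (d' : E.arith) = g * d * g⁻¹ → ψ d' = ψ d) →
          ∀ d, ψ d = 1 :=
  ⟨E.invariantCharacters_trivial_of_thm26i hG, E.thm26i_of_isFreeProcyclic hG hΔ⟩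

/-- **Thm 2.6 (i) is equivalent to its rank clause** (given `G ≅ Ẑ` and Prop 2.2): the typed
predicate `E.Thm26i` — topological finite generation of `Π`, "`Ker(Π ↠ G) = Ker(Π ↠ Π^{ab-t})`",
and "`δ¹_l(H) = 1` for every open `H ⊆ Π` and every prime `l`" — holds iff its last clause does:
the rank clause forces the Weil input (`invariantCharacters_trivial_of_freeProlRank_le_one`), which
with `G ≅ Ẑ` and Prop 2.2 gives all three clauses (`thm26i_of_isFreeProcyclic`).
[cite: MochizukiAbsTopI2012, Thm 2.6 (i) p.21] -/
theorem thm26i_iff_rank_of_isFreeProcyclic (hG : IsFreeProcyclic E.gal) (hΔ : E.GeomTFG) :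
    E.Thm26i ↔ ∀ (H : Subgroup E.arith), IsOpen (H : Set E.arith) → ∀ (l : ℕ) [Fact l.Prime],
      freeProlRank H l = 1 := by
  refine ⟨fun h => h.2.2, fun h => E.thm26i_of_isFreeProcyclic hG hΔ fun H hH l _ ψ hψ => ?_⟩
  exact E.invariantCharacters_trivial_of_freeProlRank_le_one hG H hH l (le_of_eq (h H hH l)) ψ hψ

end FundamentalExtension

end Literature.AnabelianGeometry.AbsoluteAnabelian
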